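import Mathlib
import Literature.Analysis.FluidPDE.Tao2016AveragedNS.RestartedCascadeFlows
import Summits.NavierStokesRegularity.NavierStokesRegularity.Theses.TaoLadderRungThree
import HarnessLib

/-!
# `GappedFrontRobust`, tools for the (step) clause: the ENERGY CAP of a pseudo-flow (helper for
  item stmt-NavierStokesRegularity-20423, crux K_B of routes TaoLadderRungThree / TaoLadderRungTwo)

HONEST FRAMING: elementary calculus lemmas about Tao-type MODEL lattice pseudo-flows (Tao 2016, §4
(4.9)–(4.10): the local energy inequality has no defect term, so the energy of every shell of a
pseudo-flow is capped by its start value plus the cumulative transfer, and the amplitude by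
`√(2F)`), in the cell vocabulary `TaoCascade.PseudoFlowOn` of the tree module `RestartedCascadeFlows`.
This is the "energy cap" half of the mechanism the route names for the far-ahead shells of the
(step) clause (`stub_gappedStep` of the registered skeleton on stmt-20423); it proves no step by
itself. Nothing here is a statement about the Navier–Stokes equations.

CONTENTS. `sub_le_integral_of_derivWithin_le` (integrating a one-sided differential inequality on
`[0, τ]`), `continuousOn_quadTerm`, `pseudoFlowOn_energy_cap`
(`F_{i,k}(s) ≤ F₀_{i,k} + ∫₀^s quadTerm(S)_{i,k} S_{i,k}`), `pseudoFlowOn_abs_le_sqrt`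
(`|S_{i,k}(s)| ≤ √(2 F_{i,k}(s))`), `pseudoFlowOn_sq_le_cap` (the two combined).
-/

noncomputable section

-- the sub-problem namespace `Summit.NavierStokesRegularity.NavierStokesRegularity` repeats the summit name by design (D-0017)
set_option linter.dupNamespace false

namespace Summit.NavierStokesRegularity.NavierStokesRegularity.Theorems

open Set MeasureTheory intervalIntegral Literature.Analysis.FluidPDE Literature.Analysis.FluidPDE.TaoCascade

namespace GappedFrontRobust

/-- **Integrating a one-sided differential inequality**: if `f` is `C¹` on `[0, τ]` (`τ > 0`) with
`∂f ≤ g` there (derivative within `[0, τ]`, `g` continuous), then `f(s) − f(0) ≤ ∫₀^s g` for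
`s ∈ [0, τ]`. [folklore] -/
theorem sub_le_integral_of_derivWithin_le {f g : ℝ → ℝ} {τ s : ℝ} (hτ : 0 < τ)
    (hf : ContDiffOn ℝ 1 f (Icc 0 τ)) (hg : ContinuousOn g (Icc 0 τ))
    (hle : ∀ u ∈ Icc 0 τ, derivWithin f (Icc 0 τ) u ≤ g u) (hs : s ∈ Icc 0 τ) :
    f s - f 0 ≤ ∫ u in (0 : ℝ)..s, g u := by
  have hsub : Icc 0 s ⊆ Icc 0 τ := Icc_subset_Icc_right hs.2
  have hcont : ContinuousOn f (Icc 0 s) := hf.continuousOn.mono hsub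
  have hf'cont : ContinuousOn (derivWithin f (Icc 0 τ)) (Icc 0 τ) :=
    hf.continuousOn_derivWithin (uniqueDiffOn_Icc hτ) le_rfl
  have hint : IntervalIntegrable (derivWithin f (Icc 0 τ)) volume 0 s := by
    refine (hf'cont.mono ?_).intervalIntegrable
    rw [uIcc_of_le hs.1]
    exact hsub
  have hgint : IntervalIntegrable g volume 0 s := by
    refine (hg.mono ?_).intervalIntegrable
    rw [uIcc_of_le hs.1]
    exact hsub
  have hderiv : ∀ x ∈ Ioo 0 s, HasDerivAt f (derivWithin f (Icc 0 τ) x) x := by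
    intro x hx
    have hxτ : x < τ := hx.2.trans_le hs.2
    have hxI : Icc 0 τ ∈ nhds x := Icc_mem_nhds hx.1 hxτ
    have hd : DifferentiableWithinAt ℝ f (Icc 0 τ) x :=
      (hf.differentiableOn one_ne_zero) x ⟨hx.1.le, hxτ.le⟩
    rw [derivWithin_of_mem_nhds hxI]
    exact (hd.differentiableAt hxI).hasDerivAt
  have hftc := intervalIntegral.integral_eq_sub_of_hasDerivAt_of_le hs.1 hcont hderiv hint
  rw [← hftc]
  exact intervalIntegral.integral_mono_on hs.1 hint hgint fun u hu => hle u (hsub hu)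

/-- The quadratic term of a family of continuous amplitudes is continuous (finite sum of products).
[cite: Tao2016AveragedNS, §4 (4.8) (the bilinear term)] -/
theorem continuousOn_quadTerm {ε₀ : ℝ} {m : ℕ} (α : Fin m → Fin m → Fin m → ℤ × ℤ × ℤ → ℝ)
    {S : Fin m → ℤ → ℝ → ℝ} {I : Set ℝ} (hS : ∀ i n, ContinuousOn (S i n) I) (i : Fin m) (n : ℤ) :
    ContinuousOn (fun t => quadTerm ε₀ α S i n t) I := by
  unfold quadTerm
  refine continuousOn_finsetSum _ fun i₁ _ => continuousOn_finsetSum _ fun i₂ _ =>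
    continuousOn_finsetSum _ fun μ _ => ?_
  exact continuousOn_const.mul ((hS _ _).mul (hS _ _))

variable {τ ε₀ : ℝ} {m : ℕ} {α : Fin m → Fin m → Fin m → ℤ × ℤ × ℤ → ℝ} {κ₁ κ₂ : ℝ}
  {S₀ F₀ B₀ : Fin m → ℤ → ℝ} {S F : Fin m → ℤ → ℝ → ℝ}

/-- **Energy cap** ((4.9) has no defect term): along every pseudo-flow, for every shell,
`F_{i,k}(s) ≤ F₀_{i,k} + ∫₀^s quadTerm(S)_{i,k}(u) S_{i,k}(u) du` on `[0, τ]`.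
[cite: Tao2016AveragedNS, §4 Lemma 4.1 (4.9)] -/
theorem pseudoFlowOn_energy_cap (h : PseudoFlowOn τ ε₀ α κ₁ κ₂ S₀ F₀ B₀ S F) (hτ : 0 < τ)
    (i : Fin m) (k : ℤ) {s : ℝ} (hs : s ∈ Icc 0 τ) :
    F i k s ≤ F₀ i k + ∫ u in (0 : ℝ)..s, quadTerm ε₀ α S i k u * S i k u := by
  have hS : ∀ i' n, ContinuousOn (S i' n) (Icc 0 τ) := fun i' n => (h.contDiffOn_S i' n).continuousOn
  have hg : ContinuousOn (fun u => quadTerm ε₀ α S i k u * S i k u) (Icc 0 τ) :=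
    (continuousOn_quadTerm α hS i k).mul (hS i k)
  have h1 := sub_le_integral_of_derivWithin_le hτ (h.contDiffOn_F i k) hg
    (fun u hu => h.energy i k u hu) hs
  rw [h.init_F i k] at h1
  linarith

/-- **Amplitude by energy**: `|S_{i,k}(s)| ≤ √(2 F_{i,k}(s))` on `[0, τ]` ((4.10), lower half).
[cite: Tao2016AveragedNS, §4 Lemma 4.1 (4.10)] -/
theorem pseudoFlowOn_abs_le_sqrt (h : PseudoFlowOn τ ε₀ α κ₁ κ₂ S₀ F₀ B₀ S F) (i : Fin m) (k : ℤ)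
    {s : ℝ} (hs : s ∈ Icc 0 τ) : |S i k s| ≤ Real.sqrt (2 * F i k s) :=
  Real.abs_le_sqrt (by linarith [h.defect_lower i k s hs])

/-- **The cap on the amplitude**: `S_{i,k}(s)² ≤ 2 F₀_{i,k} + 2 ∫₀^s quadTerm(S)_{i,k} S_{i,k}` on
`[0, τ]`. [cite: Tao2016AveragedNS, §4 Lemma 4.1 (4.9)–(4.10)] -/
theorem pseudoFlowOn_sq_le_cap (h : PseudoFlowOn τ ε₀ α κ₁ κ₂ S₀ F₀ B₀ S F) (hτ : 0 < τ)
    (i : Fin m) (k : ℤ) {s : ℝ} (hs : s ∈ Icc 0 τ) :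
    S i k s ^ 2 ≤ 2 * F₀ i k + 2 * ∫ u in (0 : ℝ)..s, quadTerm ε₀ α S i k u * S i k u := by
  have h1 := h.defect_lower i k s hs
  have h2 := pseudoFlowOn_energy_cap h hτ i k hs
  linarith

end GappedFrontRobust

end Summit.NavierStokesRegularity.NavierStokesRegularity.Theorems

end
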